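import Mathlib

/-!
# Submodules of a multiplicity-free sum of simple modules (Tier 5, sub-step N3, Lemma N3.L8 (3))

Kernel annex for Tier 5 (README §7), filed by p8 as a companion to `route/T5-CHECK-N3-p8.md`.
Step (3) of Lemma N3.L8 of `route/T5-N3-route-2.md` (the assembly «both sides ⟹ (N)») uses:
a `G(𝔸_f)`-submodule `N` of an algebraic direct sum `⊕_{σ′} σ′_f` of PAIRWISE NON-ISOMORPHIC
irreducible smooth modules satisfies `N = ⊕_{σ′} (N ∩ σ′_f)`. This file kernel-checks that
statement for modules over a ring (the smooth `G(𝔸_f)`-modules of the prose are modules over the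
Hecke algebra; irreducible = simple): if `M` is the internal direct sum of submodules `S i`, each
simple and pairwise non-isomorphic, then every submodule `N` of `M` is the sum of its
intersections `N ⊓ S i`, and each `N ⊓ S i` is `⊥` or `S i`.

Proof (the one of N3.L8 (3), made precise with Mathlib's semisimple-module API): `M` is
semisimple, so `N' := ⨆ i, N ⊓ S i ≤ N` has a complement `C` inside `N`; if `C ≠ ⊥` it contains a
simple submodule `T`, which is isomorphic to some `S j` (`Submodule.linearEquiv_of_le_sSup`);
for `i ≠ j` the projection `T → S i` vanishes by Schur's lemma (`LinearMap.bijective_or_eq_zero`)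
and non-isomorphism, so `T ≤ S j`, hence `T ≤ N ⊓ S j ≤ N'`, contradicting `T ⊓ N' = ⊥` and
`T ≠ ⊥`. Nothing representation-theoretic beyond this is asserted.
-/

namespace Summit.Ventures.HodgeRepro2.T5Reduction

open DirectSum

variable {R : Type*} [Ring R] {M : Type*} [AddCommGroup M] [Module R M]
  {ι : Type*} [DecidableEq ι] [Fintype ι] (S : ι → Submodule R M)

section Projections

variable (h : DirectSum.IsInternal S)

/-- The projection onto the `i`-th summand of an internal direct sum. -/
noncomputable def proj (i : ι) : M →ₗ[R] S i :=
  (DirectSum.component R ι (fun i => S i) i) ∘ₗ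
    (LinearEquiv.ofBijective (DirectSum.coeLinearMap S) h).symm.toLinearMap

/-- Every vector is the sum of its projections. -/
theorem sum_proj (x : M) : ∑ i, (proj S h i x : M) = x := by
  set e := LinearEquiv.ofBijective (DirectSum.coeLinearMap S) h with he
  have hx : x = e (e.symm x) := (e.apply_symm_apply x).symm
  conv_rhs => rw [hx]
  rw [← DirectSum.sum_univ_of (e.symm x)]
  simp only [he, LinearEquiv.ofBijective_apply, map_sum, DirectSum.coeLinearMap_of]
  rfl

end Projections

section Isotypic

variable (h : DirectSum.IsInternal S) [hS : ∀ i, IsSimpleModule R (S i)]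
  (hne : ∀ i j, i ≠ j → IsEmpty (S i ≃ₗ[R] S j))

include h hS hne in
/-- A simple submodule `T ≤ M` isomorphic to `S j` lies in `S j`: all its other projections
vanish by Schur's lemma and non-isomorphism. -/
theorem le_of_linearEquiv {T : Submodule R M} [IsSimpleModule R T] {j : ι} (e : T ≃ₗ[R] S j) :
    T ≤ S j := by
  intro x hx
  have hsum := sum_proj S h x
  have hzero : ∀ i, i ≠ j → (proj S h i x : M) = 0 := by
    intro i hij
    -- the map T → S i, restricted projection, is zero by Schur
    have hmap : (proj S h i) ∘ₗ T.subtype = 0 := by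
      rcases LinearMap.bijective_or_eq_zero ((proj S h i) ∘ₗ T.subtype) with hb | hz
      · exfalso
        have e' : S i ≃ₗ[R] S j := (LinearEquiv.ofBijective _ hb).symm.trans e
        exact (hne i j hij).false e'
      · exact hz
    have := congrArg (fun f => (f ⟨x, hx⟩ : M)) hmap
    simpa using this
  have : (∑ i, (proj S h i x : M)) = (proj S h j x : M) := by
    rw [Finset.sum_eq_single j]
    · intro i _ hij
      exact hzero i hij
    · intro hj
      exact absurd (Finset.mem_univ j) hj
  rw [← hsum, this]
  exact (proj S h j x).2

include h hS hne in
/-- Lemma N3.L8 (3): a submodule of a multiplicity-free internal direct sum of simple submodules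
is the sum of its intersections with the summands. -/
theorem eq_iSup_inf (N : Submodule R M) : N = ⨆ i, N ⊓ S i := by
  classical
  -- M is semisimple
  haveI : IsSemisimpleModule R M :=
    isSemisimpleModule_of_isSemisimpleModule_submodule' (p := S)
      (fun i => inferInstance) h.submodule_iSup_eq_top
  set N' : Submodule R M := ⨆ i, N ⊓ S i with hN'
  have hle : N' ≤ N := iSup_le fun i => inf_le_left
  refine le_antisymm ?_ hle
  -- a complement of N' inside N
  obtain ⟨C₀, hC₀⟩ := exists_isCompl N'
  set C : Submodule R M := C₀ ⊓ N with hC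
  have hsup : N' ⊔ C = N := by
    rw [hC, ← sup_inf_assoc_of_le _ hle, hC₀.sup_eq_top, top_inf_eq]
  have hdisj : Disjoint N' C := hC₀.disjoint.mono_right inf_le_left
  by_contra hlt
  have hCne : C ≠ ⊥ := by
    intro hCbot
    apply hlt
    rw [← hsup, hCbot, sup_bot_eq]
  -- C contains a simple submodule T
  obtain ⟨T, hTC, hT⟩ := (IsSemisimpleModule.eq_bot_or_exists_simple_le C).resolve_left hCne
  -- T is isomorphic to some S j
  have hTsup : T ≤ sSup (Set.range S) := by
    rw [sSup_range, h.submodule_iSup_eq_top]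
    exact le_top
  haveI : ∀ m : Set.range S, IsSimpleModule R m := by
    rintro ⟨m, i, rfl⟩
    exact hS i
  obtain ⟨m, ⟨j, rfl⟩, ⟨e⟩⟩ := T.linearEquiv_of_le_sSup (Set.range S) hTsup
  -- hence T ≤ S j, so T ≤ N ⊓ S j ≤ N', contradicting T ≤ C and T ≠ ⊥
  have hTS : T ≤ S j := le_of_linearEquiv S h hne e
  have hTN : T ≤ N := hTC.trans inf_le_right
  have hTN' : T ≤ N' := (le_inf hTN hTS).trans (le_iSup (fun i => N ⊓ S i) j)
  have hTbot : T = ⊥ := le_bot_iff.1 ((le_inf hTN' hTC).trans hdisj.le_bot)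
  exact (isSimpleModule_iff_isAtom.mp hT).ne_bot hTbot

omit [DecidableEq ι] [Fintype ι] in
include hS in
/-- Each intersection `N ⊓ S i` is `⊥` or all of `S i`. -/
theorem inf_eq_bot_or_eq (N : Submodule R M) (i : ι) : N ⊓ S i = ⊥ ∨ N ⊓ S i = S i := by
  have hatom : IsAtom (S i) := isSimpleModule_iff_isAtom.mp (hS i)
  rcases hatom.le_iff.mp (inf_le_right : N ⊓ S i ≤ S i) with hb | he
  · exact Or.inl hb
  · exact Or.inr he

omit [DecidableEq ι] [Fintype ι] in
include hS in
/-- The form used in N3.L8 (4): a submodule meeting `S j` non-trivially contains `S j`. -/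
theorem le_of_inf_ne_bot (N : Submodule R M) (j : ι) (hne' : N ⊓ S j ≠ ⊥) : S j ≤ N := by
  rcases inf_eq_bot_or_eq S N j with hb | he
  · exact absurd hb hne'
  · exact he ▸ inf_le_left

end Isotypic

end Summit.Ventures.HodgeRepro2.T5Reduction
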